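import Summits.CriticalPhenomena.CardyFormulaZ2.Theorems.CardyQContinuationIsingJetsConformalStubDesignMeshQuadTube

/-!
# Tubes along the edges of a rectilinear simple polygon, II: the two tube lemmas
(route CardyQContinuation, serves stmt-CriticalPhenomena-5560: helper for the registered stub
`stub_design_meshQuad` of the n = 0 bridge of the crux `IsingJetsConformal`)

Let `l` be a rectilinear simple closed polygon whose vertex abscissae (resp. ordinates) are equal
or at least `g` apart, and whose inside `P` lies locally to the left of every edge. We rotate each
edge `v → w` to the positive real direction (`edgeRot`, one of `±1, ±i`, as a real-linear
automorphism `rotCLE`) and prove the two **tube lemmas**: the closed band of width `g/2` on the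
left of the edge lies in `closure P` (`closedBand_subset_closure`), and a point of the open band
of width `g` on the right of the open edge, off the vertical lines through the vertices, lies
outside `closure P` (`not_mem_closure_of_mem_lowerBand`). The proofs combine monochromatic
vertex-free boxes with the fact that every point of the Jordan curve `∂P` is a limit of exterior
points. [folklore]
-/

noncomputable section

namespace Summit.CriticalPhenomena.CardyFormulaZ2.Theorems.CardyQContinuation

namespace Tube

open Set Complex Filter Topology Literature.Probability.RandomPlanarGeometry

section Edges

variable {l : List ℂ} (h : IsSimpleClosedPolygon l) {g : ℝ}
  (hrect : ∀ (k : ℕ) (hk : k < l.length),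
    (l[k]).re = (l[(k + 1) % l.length]'(Nat.mod_lt _ h.pos)).re ∨
    (l[k]).im = (l[(k + 1) % l.length]'(Nat.mod_lt _ h.pos)).im)
  (hgre : ∀ (i j : ℕ) (hi : i < l.length) (hj : j < l.length),
    |(l[i]).re - (l[j]).re| < g → (l[i]).re = (l[j]).re)
  (hgim : ∀ (i j : ℕ) (hi : i < l.length) (hj : j < l.length),
    |(l[i]).im - (l[j]).im| < g → (l[i]).im = (l[j]).im)
  (hin : ∀ (k : ℕ) (hk : k < l.length) (θ : ℝ), θ ∈ Ioo (0 : ℝ) 1 →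
    ∀ᶠ s : ℝ in 𝓝[>] (0 : ℝ), polygonLoop l ((k + θ) / l.length) +
      (s : ℂ) * (I * (l[(k + 1) % l.length]'(Nat.mod_lt _ h.pos) - l[k])) ∈ (polygonDomain l h).carrier)

/-! ### The tube lemmas -/

include hrect hgre hgim hin in
/-- **Points above the open edge, off the vertex abscissae, are inside.** [folklore] -/
theorem mem_of_above (hg : 0 < g) (k : ℕ) (hk : k < l.length) {z : ℂ}
    (hz1 : (σ h k hk l[k]).re < (σ h k hk z).re)
    (hz2 : (σ h k hk z).re < (σ h k hk (l[(k + 1) % l.length]'(Nat.mod_lt _ h.pos))).re)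
    (hzX : (σ h k hk z).re ∉ absc h k hk)
    (hz3 : (σ h k hk l[k]).im < (σ h k hk z).im) (hz4 : (σ h k hk z).im < (σ h k hk l[k]).im + g) :
    z ∈ (polygonDomain l h).carrier := by
  obtain ⟨p, q, -, hpx, hxq, -, hfree⟩ := exists_free_Ioo h k hk (mem_absc h k hk hk)
    (mem_absc h k hk (Nat.mod_lt _ h.pos)) hz1 hz2 hzX
  obtain ⟨y, hyP, hyB⟩ := exists_mem_above h hrect hin hg k hk ⟨hpx, hxq⟩ hz1 hz2
  rcases box_mono h hrect hgre hgim k hk hfree (Or.inl ⟨rfl, rfl⟩) with hsub | hsub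
  · exact hsub (show z ∈ _ from mem_preimage.2 (mem_reProdIm.2 ⟨⟨hpx, hxq⟩, hz3, hz4⟩))
  · exact absurd (subset_closure hyP) (hsub hyB)

include hrect hgre hgim hin in
/-- **Tube lemma, inner side.** The closed band of width `g/2` on the left of the (closed) edge lies
in `closure P`. [folklore] -/
theorem closedBand_subset_closure (hg : 0 < g) (k : ℕ) (hk : k < l.length) :
    σ h k hk ⁻¹' (Icc (σ h k hk l[k]).re (σ h k hk (l[(k + 1) % l.length]'(Nat.mod_lt _ h.pos))).re ×ℂ
        Icc (σ h k hk l[k]).im ((σ h k hk l[k]).im + g / 2)) ⊆ closure (polygonDomain l h).carrier := by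
  classical
  set a := (σ h k hk l[k]).re
  set b := (σ h k hk (l[(k + 1) % l.length]'(Nat.mod_lt _ h.pos))).re
  set β := (σ h k hk l[k]).im
  obtain ⟨hre, -⟩ := σ_edge_re_im h hrect k hk
  obtain ⟨-, hpos⟩ := σ_edge h hrect k hk
  have hab : a < b := by simp only [a, b]; linarith
  -- the dense inner part
  set S : Set ℝ := Ioo a b \ ↑(absc h k hk) with hS
  set U : Set ℝ := Ioo β (β + g) with hU
  have hG : σ h k hk ⁻¹' (S ×ℂ U) ⊆ (polygonDomain l h).carrier := by
    intro z hz
    rw [mem_preimage, mem_reProdIm] at hz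
    obtain ⟨⟨⟨hz1, hz2⟩, hzX⟩, hz3, hz4⟩ := hz
    exact mem_of_above h hrect hgre hgim hin hg k hk hz1 hz2 hzX hz3 hz4
  -- closures
  have hS' : Icc a b ⊆ closure S := by
    have hd : Dense ((↑(absc h k hk) : Set ℝ)ᶜ) :=
      (dense_univ.sdiff_finite (absc h k hk).finite_toSet).mono (fun x hx ↦ hx.2)
    have h1 : Ioo a b ⊆ closure S := hd.open_subset_closure_inter isOpen_Ioo
    rw [← closure_Ioo hab.ne]
    exact closure_minimal h1 isClosed_closure
  have hU' : Icc β (β + g / 2) ⊆ closure U := by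
    rw [hU, closure_Ioo (by linarith : β ≠ β + g)]
    exact Icc_subset_Icc le_rfl (by linarith)
  intro z hz
  rw [mem_preimage, mem_reProdIm] at hz
  have hz' : σ h k hk z ∈ closure (S ×ℂ U) := by
    rw [Complex.closure_reProdIm]
    exact ⟨hS' hz.1, hU' hz.2⟩
  -- pull back the closure through the homeomorphism `σ`
  have : z ∈ closure (σ h k hk ⁻¹' (S ×ℂ U)) := by
    have h' : z ∈ (σ h k hk).toHomeomorph ⁻¹' closure (S ×ℂ U) := hz'
    rwa [Homeomorph.preimage_closure] at h'
  exact closure_mono hG this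

include hrect hgre hgim hin in
/-- **Tube lemma, outer side.** A point of the open band of width `g` on the right of the open
edge, whose rotated abscissa is not a vertex abscissa, lies outside `closure P`: otherwise the
vertex-free box below it lies inside `P`, so the whole open box around the edge point above it
lies in `closure P`, contradicting that every point of the Jordan curve `∂P` is a limit of
exterior points. [folklore] -/
theorem not_mem_closure_of_below (hg : 0 < g) (k : ℕ) (hk : k < l.length) {z : ℂ}
    (hz1 : (σ h k hk l[k]).re < (σ h k hk z).re)
    (hz2 : (σ h k hk z).re < (σ h k hk (l[(k + 1) % l.length]'(Nat.mod_lt _ h.pos))).re)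
    (hzX : (σ h k hk z).re ∉ absc h k hk)
    (hz3 : (σ h k hk l[k]).im - g < (σ h k hk z).im) (hz4 : (σ h k hk z).im < (σ h k hk l[k]).im) :
    z ∉ closure (polygonDomain l h).carrier := by
  set β := (σ h k hk l[k]).im with hβ
  set x := (σ h k hk z).re with hx
  obtain ⟨p, q, hap, hpx, hxq, hqb, hfree⟩ := exists_free_Ioo h k hk (mem_absc h k hk hk)
    (mem_absc h k hk (Nat.mod_lt _ h.pos)) hz1 hz2 hzX
  rcases box_mono h hrect hgre hgim k hk hfree (Or.inr ⟨rfl, rfl⟩) with hlow | hlow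
  swap
  · exact hlow (show z ∈ _ from mem_preimage.2 (mem_reProdIm.2 ⟨⟨hpx, hxq⟩, by linarith, hz4⟩))
  -- the lower box is inside; so is the upper box
  exfalso
  have hup : σ h k hk ⁻¹' (Ioo p q ×ℂ Ioo β (β + g)) ⊆ (polygonDomain l h).carrier := by
    obtain ⟨y, hyP, hyB⟩ := exists_mem_above h hrect hin hg k hk ⟨hpx, hxq⟩ hz1 hz2
    rcases box_mono h hrect hgre hgim k hk hfree (Or.inl ⟨rfl, rfl⟩) with hsub | hsub
    · exact hsub
    · exact absurd (subset_closure hyP) (hsub hyB)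
  -- the edge point above `z`
  obtain ⟨hre, him⟩ := σ_edge_re_im h hrect k hk
  set e : ℂ := (σ h k hk).symm ⟨x, β⟩ with he
  have hσe : σ h k hk e = ⟨x, β⟩ := by rw [he, ContinuousLinearEquiv.apply_symm_apply]
  have heF : e ∈ frontier (polygonDomain l h).carrier := by
    refine h.segment_subset_frontier hk (mem_segment_of_re_im_apply (σ h k hk) (Or.inr him.symm) ?_ ?_)
    · rw [hσe]; exact mem_uIcc.2 (Or.inl ⟨hz1.le, hz2.le⟩)
    · rw [hσe, him, uIcc_self, mem_singleton_iff]
  -- the open box around it lies in `closure P`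
  set B : Set ℂ := σ h k hk ⁻¹' (Ioo p q ×ℂ Ioo (β - g) (β + g)) with hB
  have hBo : IsOpen B := (isOpen_Ioo.reProdIm isOpen_Ioo).preimage (σ h k hk).continuous
  have heB : e ∈ B := by
    rw [hB, mem_preimage, hσe, mem_reProdIm]
    exact ⟨⟨hpx, hxq⟩, by show β - g < β ∧ β < β + g; constructor <;> linarith⟩
  have hBc : B ⊆ closure (polygonDomain l h).carrier := by
    intro y hy
    rw [hB, mem_preimage, mem_reProdIm] at hy
    obtain ⟨hyre, hyim⟩ := hy
    rcases lt_trichotomy (σ h k hk y).im β with hlt | heq | hgt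
    · exact subset_closure (hlow (mem_preimage.2 (mem_reProdIm.2 ⟨hyre, hyim.1, hlt⟩)))
    · refine frontier_subset_closure (h.segment_subset_frontier hk
        (mem_segment_of_re_im_apply (σ h k hk) (Or.inr him.symm) ?_ ?_))
      · exact mem_uIcc.2 (Or.inl ⟨by linarith [hyre.1], by linarith [hyre.2]⟩)
      · rw [heq, him, uIcc_self, mem_singleton_iff]
    · exact subset_closure (hup (mem_preimage.2 (mem_reProdIm.2 ⟨hyre, hgt, hyim.2⟩)))
  -- but frontier points are limits of exterior points
  have hext := (polygonDomain l h).frontier_subset_closure_exterior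
    Literature.Topology.PlaneTopology.JordanCurveTheorem_holds heF
  rw [mem_closure_iff] at hext
  obtain ⟨y, hyB, hyext⟩ := hext B hBo heB
  exact hyext (hBc hyB)

include hrect hgre hgim hin in
/-- **Outer side, for open sets**: a nonempty open set inside the open band on the right of the
open edge contains a point outside `closure P`. [folklore] -/
theorem exists_not_mem_closure_of_below (hg : 0 < g) (k : ℕ) (hk : k < l.length) {U : Set ℂ} (hU : IsOpen U)
    (hne : U.Nonempty)
    (hsub : U ⊆ σ h k hk ⁻¹' (Ioo (σ h k hk l[k]).re (σ h k hk (l[(k + 1) % l.length]'(Nat.mod_lt _ h.pos))).re ×ℂ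
      Ioo ((σ h k hk l[k]).im - g) (σ h k hk l[k]).im)) :
    ∃ z ∈ U, z ∉ closure (polygonDomain l h).carrier := by
  -- `σ '' U` is open and nonempty; its projection to the abscissa contains an interval, hence a
  -- non-vertex abscissa
  obtain ⟨z₀, hz₀⟩ := hne
  have hUo : IsOpen ((σ h k hk).symm ⁻¹' U) := hU.preimage (σ h k hk).symm.continuous
  have hz₀' : σ h k hk z₀ ∈ (σ h k hk).symm ⁻¹' U := by simpa using hz₀
  obtain ⟨ε, hε, hball⟩ := Metric.isOpen_iff.1 hUo _ hz₀'
  -- pick an abscissa in `(re σ z₀ - ε, re σ z₀ + ε)` off the finite set of vertex abscissae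
  have hinf : (Ioo ((σ h k hk z₀).re - ε / 2) ((σ h k hk z₀).re + ε / 2) \ ↑(absc h k hk)).Nonempty := by
    refine Set.Infinite.nonempty (Set.Infinite.sdiff ?_ (absc h k hk).finite_toSet)
    exact Ioo_infinite (by linarith)
  obtain ⟨x, ⟨hx1, hx2⟩, hxX⟩ := hinf
  set z := (σ h k hk).symm ⟨x, (σ h k hk z₀).im⟩ with hz
  have hσz : σ h k hk z = ⟨x, (σ h k hk z₀).im⟩ := by rw [hz, ContinuousLinearEquiv.apply_symm_apply]
  have hzU : z ∈ U := by
    have : (⟨x, (σ h k hk z₀).im⟩ : ℂ) ∈ (σ h k hk).symm ⁻¹' U := by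
      apply hball
      rw [Metric.mem_ball, Complex.dist_eq]
      calc ‖(⟨x, (σ h k hk z₀).im⟩ : ℂ) - σ h k hk z₀‖ = |x - (σ h k hk z₀).re| := by
            rw [show (⟨x, (σ h k hk z₀).im⟩ : ℂ) - σ h k hk z₀ = ((x - (σ h k hk z₀).re : ℝ) : ℂ) from
              Complex.ext (by simp) (by simp)]
            rw [Complex.norm_real, Real.norm_eq_abs]
        _ < ε := by rw [abs_lt]; constructor <;> linarith
    simpa [hz] using this
  have hzb := hsub hzU
  rw [mem_preimage, hσz, mem_reProdIm] at hzb
  refine ⟨z, hzU, not_mem_closure_of_below h hrect hgre hgim hin hg k hk ?_ ?_ ?_ ?_ ?_⟩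
  · rw [hσz]; exact hzb.1.1
  · rw [hσz]; exact hzb.1.2
  · rw [hσz]; exact hxX
  · rw [hσz]; exact hzb.2.1
  · rw [hσz]; exact hzb.2.2

end Edges

end Tube

end Summit.CriticalPhenomena.CardyFormulaZ2.Theorems.CardyQContinuation
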